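import Literature.AlgebraicGeometry.AbelianSchemes.TorsionSectionPairing
import Literature.AlgebraicGeometry.RelativeSpec.PullbackIsoDiscrepancyTensor
import Literature.AlgebraicGeometry.Modules.TensorUnitors
import Literature.AlgebraicGeometry.Modules.DetClassTensor
import HarnessLib

/-!
# The `e_n`-pairing is multiplicative in the line bundle: `e_n(g, L ⊗ L′) = e_n(g, L) · e_n(g, L′)` ([MumfordAV1970] §20 p. 184)

Layer `Literature/AlgebraicGeometry/AbelianSchemes`, namespace `Literature.AlgebraicGeometry.AbelianSchemes.AbelianSchemeOver.TorsionPairing`.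
THEOREMS ONLY (no definition, no named fact, no instance, no notation, no `sorry`).  Sequel to ★ `TorsionSectionPairing` (the relative
character pairing `e_n(g, L) = c_g ∈ Γ(S, 𝒪_S)` of an action `ρ` over `[n]_A` with a line bundle `L` and a trivialisation
`e : [n]^* L ≅ [n]^* 𝒪_A`, DEF-FREE: `c_g` is the witness of ★ `existsUnique_pairingUnit`, independent of `e` by ★ `pairingUnit_eq_of_iso`)
over the generic lemma ★ `RelativeSpec.ActionOver.discrepancy_tensor` («the discrepancy of `e ⊗ e′` is the product of the discrepancies»,
`RelativeSpec/PullbackIsoDiscrepancyTensor`).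

Cell `hodgecm-mathlib` (D-0151), FLOOR 0, P6 «MOD programme» (crux hLiu418 = stmt-HodgeConjecture-24832), W-line
`Cruxes/HLiu418/Lines/F0_P6b_WeilCartierDuality.lean`, letter `stub_W1` «WeilPairingNatural», σ1 road (B-p08 (g32)
`F0/P6/B-p08/g32/ROAD-sigma1-WeilPairingNatural.v1.B-p08g32.md`), organ **(σ1-c)** «MULTIPLICATIVITY IN THE DUAL VARIABLE» (B-p18 (g37)), the
`TorsionPairing`-currency half; the Poincaré instance `e_n(x, ŷ ŷ′) = e_n(x, ŷ) e_n(x, ŷ′)` for B-p08's `DualPair.weilUnit` follows by ★ (P-⊗)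
`DualPair.nonempty_pullbackP_mul_iso` (`L_{ŷŷ′} ≅ L_ŷ ⊗ L_{ŷ′}`) and is typed in the sequel once `WeilUnitOfTorsionPoint` is in the tree.
HC_CM is proved only modulo the printed citations until rung 0 closes; nothing here is about HC.

THE PRINT.  [MumfordAV1970] §20 p. 184: for `L, L′ ∈ Pic⁰(X)` of order dividing `n` with trivialisations `φ : n_X^*L ≅ 𝒪`, `φ′ : n_X^*L′ ≅ 𝒪`,
the tensor product `φ ⊗ φ′` trivialises `n_X^*(L ⊗ L′)`, and the characters through which `X_n` acts multiply: «`e_n` is a homomorphism in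
each variable».  Here, over a locally Noetherian base `S` and for an arbitrary action `ρ` over `[n]_A`:
* **`pairingUnit_eq_mul_of_iso_tensor`** — if `c_g`, `c′_g` are the pairing units of `(L, e)`, `(L′, e′)` (line bundles `L`, `L′` on `A`),
  `L″` is a module with an isomorphism `m : L″ ≅ L ⊗ L′`, and `c″` satisfies the discrepancy equation at `g` of ANY trivialisation
  `e″ : [n]^* L″ ≅ [n]^* 𝒪_A`, then `c″ = c_g · c′_g`.  Proof: the trivialisation
  `E := [n]^*m ≫ θ ≫ (e ⊗ e′) ≫ θ⁻¹ ≫ [n]^*(𝒪 ⊗ 𝒪 ≅ 𝒪)` has discrepancy `([n]^♯π^♯ c_g)([n]^♯π^♯ c′_g) = [n]^♯π^♯(c_g c′_g)` (★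
  `discrepancy_tensor`, ★ `discrepancy_conj`), and pairing units do not depend on the trivialisation (★ `pairingUnit_eq_of_iso`).
* **`exists_pairingUnit_tensor`** — the existence form: `[n]^*(L ⊗ L′)` HAS a trivialisation whose pairing units are `c_g c′_g`.

## References
* [MumfordAV1970] D. Mumford, *Abelian Varieties* (1970), §20 (pp. 183–184), §12 Thm. 1 (p. 112).
* [MilneAV2008] J. S. Milne, *Abelian Varieties* (2008), I §11 (the `e_m`-pairing, bi-multiplicativity).
* Tree: ★ `TorsionSectionPairing` (`existsUnique_pairingUnit`, `pairingUnit_eq_of_iso`, `hasRank_pullback_unit`), ★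
  `RelativeSpec.PullbackIsoDiscrepancyTensor` (`discrepancy_tensor`), ★ `RelativeSpec.PullbackIsoDiscrepancy` (`discrepancy_conj`), ★
  `Modules/TensorUnitors` (`tensorUnitLeftIso`), ★ `Modules/DetClassTensor` (`hasRank_tensorObj_one`).
-/

set_option autoImplicit false

noncomputable section

-- `TopCat.Presheaf`/`Scheme.Modules` are not reducible (as in Mathlib's `AlgebraicGeometry/Modules` and ★ `TorsionSectionPairing`).
set_option backward.isDefEq.respectTransparency false

universe u

open CategoryTheory CategoryTheory.Limits AlgebraicGeometry MonoidalCategory CartesianMonoidalCategory TopologicalSpace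
  Opposite
open scoped MonObj

namespace Literature.AlgebraicGeometry.AbelianSchemes.AbelianSchemeOver.TorsionPairing

open Literature.AlgebraicGeometry.RelativeSpec Literature.AlgebraicGeometry.Modules Literature.AlgebraicGeometry.Motives
  Literature.AlgebraicGeometry.RelativeSpec.ActionOver

variable {S : Scheme.{u}} (A : AbelianSchemeOver S) {K : Type u} [Group K] {n : ℕ}
  (ρ : ActionOver (A.mulN n).left K) {L L' : A.X.left.Modules} (hL : HasRank L 1) (hL' : HasRank L' 1)
  (e : (Scheme.Modules.pullback (A.mulN n).left).obj L ≅
    (Scheme.Modules.pullback (A.mulN n).left).obj (SheafOfModules.unit A.X.left.ringCatSheaf))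
  (e' : (Scheme.Modules.pullback (A.mulN n).left).obj L' ≅
    (Scheme.Modules.pullback (A.mulN n).left).obj (SheafOfModules.unit A.X.left.ringCatSheaf))
  (c c' : K → Γ(S, ⊤))
  (hc : ∀ g : K, (Scheme.Modules.pullback (ρ.autHom g)).map e.hom ≫
        ((EquivariantStructure.ofPullback ρ (SheafOfModules.unit A.X.left.ringCatSheaf)).iso g).hom =
      ((EquivariantStructure.ofPullback ρ L).iso g).hom ≫ e.hom ≫
        globalScalar _ ((A.mulN n).left.appTop (A.X.hom.appTop (c g))))
  (hc' : ∀ g : K, (Scheme.Modules.pullback (ρ.autHom g)).map e'.hom ≫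
        ((EquivariantStructure.ofPullback ρ (SheafOfModules.unit A.X.left.ringCatSheaf)).iso g).hom =
      ((EquivariantStructure.ofPullback ρ L').iso g).hom ≫ e'.hom ≫
        globalScalar _ ((A.mulN n).left.appTop (A.X.hom.appTop (c' g))))

/-- `𝒪_A` is finite locally free (rank one). [folklore] -/
private theorem isFiniteLocallyFree_unit :
    IsFiniteLocallyFree (SheafOfModules.unit A.X.left.ringCatSheaf) :=
  HasRank.isFiniteLocallyFree' (hasRank_unitModule (X := A.X.left))

include hL hL' hc hc' in
/-- **THE TENSOR PRODUCT OF THE TRIVIALISATIONS, READ ON `L″ ≅ L ⊗ L′`, HAS PAIRING UNITS `c_g · c′_g`**: the trivialisation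
`E := [n]^*m ≫ θ ≫ (e ⊗ e′) ≫ θ⁻¹ ≫ [n]^*(𝒪 ⊗ 𝒪 ≅ 𝒪) : [n]^* L″ ≅ [n]^* 𝒪_A` satisfies the discrepancy equations with the scalars
`[n]^♯ π^♯ (c_g c′_g)` (★ `discrepancy_tensor` for `(e, e′)`, then ★ `discrepancy_conj` by `m` and the unitor ★ `tensorUnitLeftIso`).
[MumfordAV1970] §20 p. 184: «the tensor product of the trivialisations is a trivialisation of `n_X^*(L ⊗ L′)`».
[cite: MumfordAV1970, §20 (p. 184)] [cite: MumfordAV1970, §12 Thm. 1 (p. 112)] -/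
theorem exists_pairingUnit_of_iso_tensor {L'' : A.X.left.Modules} (m : L'' ≅ tensorObj L L') :
    ∃ E : (Scheme.Modules.pullback (A.mulN n).left).obj L'' ≅
        (Scheme.Modules.pullback (A.mulN n).left).obj (SheafOfModules.unit A.X.left.ringCatSheaf),
      ∀ g : K, (Scheme.Modules.pullback (ρ.autHom g)).map E.hom ≫
          ((EquivariantStructure.ofPullback ρ (SheafOfModules.unit A.X.left.ringCatSheaf)).iso g).hom =
        ((EquivariantStructure.ofPullback ρ L'').iso g).hom ≫ E.hom ≫
          globalScalar _ ((A.mulN n).left.appTop (A.X.hom.appTop (c g * c' g))) := by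
  have h₀ := isFiniteLocallyFree_unit A
  -- the tensor product of the two trivialisations, discrepancy `r_g r′_g`
  have hT := discrepancy_tensor ρ h₀ (HasRank.isFiniteLocallyFree' hL) h₀ (HasRank.isFiniteLocallyFree' hL') e e'
    (fun g => (A.mulN n).left.appTop (A.X.hom.appTop (c g))) (fun g => (A.mulN n).left.appTop (A.X.hom.appTop (c' g))) hc hc'
  -- conjugate by `m : L″ ≅ L ⊗ L′` and the unitor `𝒪 ⊗ 𝒪 ≅ 𝒪`
  refine ⟨(Scheme.Modules.pullback (A.mulN n).left).mapIso m ≪≫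
      (pullbackTensorIso (A.mulN n).left (HasRank.isFiniteLocallyFree' hL) (HasRank.isFiniteLocallyFree' hL') ≪≫ tensorMapIso e e' ≪≫
        (pullbackTensorIso (A.mulN n).left h₀ h₀).symm) ≪≫
      (Scheme.Modules.pullback (A.mulN n).left).mapIso (tensorUnitLeftIso (SheafOfModules.unit A.X.left.ringCatSheaf)),
    fun g => ?_⟩
  have hconj := discrepancy_conj ρ _ _ (pullbackTensorIso (A.mulN n).left (HasRank.isFiniteLocallyFree' hL) (HasRank.isFiniteLocallyFree' hL') ≪≫
      tensorMapIso e e' ≪≫ (pullbackTensorIso (A.mulN n).left h₀ h₀).symm)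
    (tensorUnitLeftIso (SheafOfModules.unit A.X.left.ringCatSheaf)) m _ g (hT g)
  rw [← map_mul, ← map_mul] at hconj
  exact hconj

include hL hL' hc hc' in
/-- **`e_n(g, L ⊗ L′) = e_n(g, L) · e_n(g, L′)` — MULTIPLICATIVITY OF THE PAIRING IN THE LINE BUNDLE** ([MumfordAV1970] §20 p. 184;
[MilneAV2008] I §11): for line bundles `L`, `L′` on `A` with trivialisations `e`, `e′` of `[n]^*L`, `[n]^*L′` and pairing units `c_g`, `c′_g`,
a module `L″ ≅ L ⊗ L′`, ANY trivialisation `e″ : [n]^* L″ ≅ [n]^* 𝒪_A` and any `c″` satisfying its discrepancy equation at `g`: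
`c″ = c_g · c′_g` (`exists_pairingUnit_of_iso_tensor` + independence of the trivialisation ★ `pairingUnit_eq_of_iso`; `S` locally
Noetherian for Stein). [cite: MumfordAV1970, §20 (p. 184)] [cite: MilneAV2008, I §11] -/
theorem pairingUnit_eq_mul_of_iso_tensor [IsLocallyNoetherian S] {L'' : A.X.left.Modules} (m : L'' ≅ tensorObj L L')
    (e'' : (Scheme.Modules.pullback (A.mulN n).left).obj L'' ≅
      (Scheme.Modules.pullback (A.mulN n).left).obj (SheafOfModules.unit A.X.left.ringCatSheaf))
    (g : K) (c'' : Γ(S, ⊤))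
    (hc'' : (Scheme.Modules.pullback (ρ.autHom g)).map e''.hom ≫
        ((EquivariantStructure.ofPullback ρ (SheafOfModules.unit A.X.left.ringCatSheaf)).iso g).hom =
      ((EquivariantStructure.ofPullback ρ L'').iso g).hom ≫ e''.hom ≫
        globalScalar _ ((A.mulN n).left.appTop (A.X.hom.appTop c''))) :
    c'' = c g * c' g := by
  obtain ⟨E, hE⟩ := exists_pairingUnit_of_iso_tensor A ρ hL hL' e e' c c' hc hc' m
  exact pairingUnit_eq_of_iso A ρ L'' e'' E g c'' _ hc'' (hE g)

include hL hL' hc hc' in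
/-- **The existence form on `L ⊗ L′` itself**: `[n]^*(L ⊗ L′)` has a trivialisation whose pairing units are `c_g · c′_g`.
[cite: MumfordAV1970, §20 (p. 184)] -/
theorem exists_pairingUnit_tensor :
    ∃ E : (Scheme.Modules.pullback (A.mulN n).left).obj (tensorObj L L') ≅
        (Scheme.Modules.pullback (A.mulN n).left).obj (SheafOfModules.unit A.X.left.ringCatSheaf),
      ∀ g : K, (Scheme.Modules.pullback (ρ.autHom g)).map E.hom ≫
          ((EquivariantStructure.ofPullback ρ (SheafOfModules.unit A.X.left.ringCatSheaf)).iso g).hom =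
        ((EquivariantStructure.ofPullback ρ (tensorObj L L')).iso g).hom ≫ E.hom ≫
          globalScalar _ ((A.mulN n).left.appTop (A.X.hom.appTop (c g * c' g))) :=
  exists_pairingUnit_of_iso_tensor A ρ hL hL' e e' c c' hc hc' (Iso.refl _)

include hL hL' hc hc' in
/-- **The uniqueness form on `L ⊗ L′` itself**: any solution `c″` of the discrepancy equation at `g` of any trivialisation of
`[n]^*(L ⊗ L′)` is `c_g · c′_g`. [cite: MumfordAV1970, §20 (p. 184)] [cite: MilneAV2008, I §11] -/
theorem pairingUnit_tensor_eq_mul [IsLocallyNoetherian S]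
    (e'' : (Scheme.Modules.pullback (A.mulN n).left).obj (tensorObj L L') ≅
      (Scheme.Modules.pullback (A.mulN n).left).obj (SheafOfModules.unit A.X.left.ringCatSheaf))
    (g : K) (c'' : Γ(S, ⊤))
    (hc'' : (Scheme.Modules.pullback (ρ.autHom g)).map e''.hom ≫
        ((EquivariantStructure.ofPullback ρ (SheafOfModules.unit A.X.left.ringCatSheaf)).iso g).hom =
      ((EquivariantStructure.ofPullback ρ (tensorObj L L')).iso g).hom ≫ e''.hom ≫
        globalScalar _ ((A.mulN n).left.appTop (A.X.hom.appTop c''))) :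
    c'' = c g * c' g :=
  pairingUnit_eq_mul_of_iso_tensor A ρ hL hL' e e' c c' hc hc' (Iso.refl _) e'' g c'' hc''

end Literature.AlgebraicGeometry.AbelianSchemes.AbelianSchemeOver.TorsionPairing

end
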